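import Summits.Ventures.PercRepro.S1PairInjection
import Summits.Ventures.PercRepro.S1PlaneCounts

/-!
# PercRepro — S1 LEMMA K, THE FIVE-SUBSETS COUNTED ONCE: the weights (p2, gen 15; SUBCLAIM-S1 §4 (A9))

Per rank-`4` flat `F`, the sets `B ⊆ F` with `cl(B) = F` and `|B| = 5` have rank `4`, i.e. they ARE the rank-`4`
five-subsets of `F` (`rank4Five M F`, at most `#pairsOf(F)` by the injection); only the subsets of size `≥ 6` are
counted crudely. So a flat costs `7560·(#rank4Five(F) + βK_c(|F|))` with `βK_c(f) = Σ_{j=6}^{min(f,c)} C(f, j)`,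
which is `≤ RSK c · #pairsOf(F)` (small flats) resp. `≤ RBK c · #pairsOf(F)` (big flats) with
`RSK c = 7560 + max(1512·βK_c(6), 504·βK_c(7))`, `RBK c = 7560 + max(270·βK_c(8), 100·βK_c(9), 45·βK_c(10))`
(`S1PairInjection` charged `β_c(f) = Σ_{j=5}^{min(f,c)} C(f, j)`, all five-subsets). With Lemmas J and J′:

* `betaK`, `RSK`, `RBK`, `ncard_subsets_Icc_six_le`, **`weight_small_K`**, **`weight_big_K`**.
The count with these weights is `S1JointPerFlat3`. Axioms: standard.
-/

open scoped Matroid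

namespace PercRepro

namespace S1

open Set

variable {α : Type}

/-- `βK_c(f) = Σ_{j=6}^{min(f,c)} C(f, j)`: the subsets of an `f`-set with `6 ≤ |B| ≤ c`. -/
def betaK (f c : ℕ) : ℕ := ∑ j ∈ Finset.Icc 6 (min f c), f.choose j

/-- `RSK(c) = 7560 + max(1512·βK_c(6), 504·βK_c(7))`. -/
def RSK (c : ℕ) : ℕ := 7560 + max (1512 * betaK 6 c) (504 * betaK 7 c)

/-- `RBK(c) = 7560 + max(270·βK_c(8), 100·βK_c(9), 45·βK_c(10))`. -/
def RBK (c : ℕ) : ℕ := 7560 + max (270 * betaK 8 c) (max (100 * betaK 9 c) (45 * betaK 10 c))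

/-- `βK_c(5) = 0`. -/
theorem betaK_five (c : ℕ) : betaK 5 c = 0 := by
  unfold betaK
  rw [Finset.Icc_eq_empty (by omega), Finset.sum_empty]

/-- The subsets `B ⊆ F` with `6 ≤ |B| ≤ c` number at most `βK_c(|F|)`. -/
theorem ncard_subsets_Icc_six_le {F : Set α} (hFfin : F.Finite) (c : ℕ) :
    {B : Set α | B ⊆ F ∧ 6 ≤ B.ncard ∧ B.ncard ≤ c}.ncard ≤ betaK F.ncard c := by
  classical
  have hsub : {B : Set α | B ⊆ F ∧ 6 ≤ B.ncard ∧ B.ncard ≤ c} ⊆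
      ((Finset.Icc 6 (min F.ncard c)).biUnion
        (fun j => (hFfin.toFinset.powersetCard j).image (fun s : Finset α => (s : Set α))) : Finset (Set α)) := by
    intro B hB
    obtain ⟨hBF, h6, hc⟩ := hB
    rw [Finset.mem_coe, Finset.mem_biUnion]
    refine ⟨B.ncard, ?_, (mem_image_powersetCard_iff hFfin _ B).2 ⟨hBF, rfl⟩⟩
    rw [Finset.mem_Icc]
    exact ⟨h6, le_min (Set.ncard_le_ncard hBF hFfin) hc⟩
  calc {B : Set α | B ⊆ F ∧ 6 ≤ B.ncard ∧ B.ncard ≤ c}.ncard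
      ≤ (((Finset.Icc 6 (min F.ncard c)).biUnion
        (fun j => (hFfin.toFinset.powersetCard j).image (fun s : Finset α => (s : Set α))) : Finset (Set α)) :
          Set (Set α)).ncard := Set.ncard_le_ncard hsub (Finset.finite_toSet _)
    _ = ((Finset.Icc 6 (min F.ncard c)).biUnion
        (fun j => (hFfin.toFinset.powersetCard j).image (fun s : Finset α => (s : Set α)))).card :=
          Set.ncard_coe_finset _
    _ ≤ ∑ j ∈ Finset.Icc 6 (min F.ncard c),
        ((hFfin.toFinset.powersetCard j).image (fun s : Finset α => (s : Set α))).card :=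
          Finset.card_biUnion_le
    _ = betaK F.ncard c := by
          unfold betaK
          apply Finset.sum_congr rfl
          intro j _
          exact card_image_powersetCard hFfin j

/-- **The small flats** (`5 ≤ |F| ≤ 7`): `7560·(#rank4Five(F) + βK_c(|F|)) ≤ RSK c · #pairsOf(F)`. -/
theorem weight_small_K (M : Matroid α) [M.Finite]
    (hline : ∀ L ⊆ M.E, M.eRk L ≤ 2 → L.ncard ≤ 3) (hplane : ∀ P ⊆ M.E, M.eRk P ≤ 3 → P.ncard ≤ 6)
    {F : Set α} (hF : F ⊆ M.E) (hcl : M.closure F = F) (hr : M.eRk F = 4) (h5 : 5 ≤ F.ncard)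
    (h7 : F.ncard ≤ 7) (c : ℕ) :
    7560 * ((rank4Five M F).ncard + betaK F.ncard c) ≤ RSK c * (pairsOf M F).ncard := by
  have hinj := ncard_rank4Five_le_ncard_pairsOf M hF hcl hr
  have hRS1 : 7560 ≤ RSK c := Nat.le_add_right _ _
  have hRS2 : 7560 + 1512 * betaK 6 c ≤ RSK c := Nat.add_le_add_left (le_max_left _ _) _
  have hRS3 : 7560 + 504 * betaK 7 c ≤ RSK c := Nat.add_le_add_left (le_max_right _ _) _
  have h57 : F.ncard = 5 ∨ F.ncard = 6 ∨ F.ncard = 7 := by omega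
  rcases h57 with h | h | h
  · rw [h, betaK_five]
    nlinarith
  · have hμ := five_le_ncard_rank4Five_of_six M hline hplane hF hcl hr h
    rw [h]
    nlinarith
  · have hμ := fifteen_le_ncard_rank4Five_of_seven M hline hplane hF hcl hr h
    rw [h]
    nlinarith

/-- **The big flats** (`8 ≤ |F| ≤ 10`): `7560·(#rank4Five(F) + βK_c(|F|)) ≤ RBK c · #pairsOf(F)`. -/
theorem weight_big_K (M : Matroid α) [M.Finite]
    (hline : ∀ L ⊆ M.E, M.eRk L ≤ 2 → L.ncard ≤ 3) (hplane : ∀ P ⊆ M.E, M.eRk P ≤ 3 → P.ncard ≤ 6)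
    {F : Set α} (hF : F ⊆ M.E) (hcl : M.closure F = F) (hr : M.eRk F = 4) (h8 : 8 ≤ F.ncard)
    (h10 : F.ncard ≤ 10) (c : ℕ) :
    7560 * ((rank4Five M F).ncard + betaK F.ncard c) ≤ RBK c * (pairsOf M F).ncard := by
  have hinj := ncard_rank4Five_le_ncard_pairsOf M hF hcl hr
  have hμ := five_mul_choose_le_ncard_rank4Five M hline hplane hF hcl hr
  have hRB1 : 7560 + 270 * betaK 8 c ≤ RBK c := Nat.add_le_add_left (le_max_left _ _) _
  have hRB2 : 7560 + 100 * betaK 9 c ≤ RBK c :=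
    Nat.add_le_add_left ((le_max_left _ _).trans (le_max_right _ _)) _
  have hRB3 : 7560 + 45 * betaK 10 c ≤ RBK c :=
    Nat.add_le_add_left ((le_max_right _ _).trans (le_max_right _ _)) _
  have h810 : F.ncard = 8 ∨ F.ncard = 9 ∨ F.ncard = 10 := by omega
  rcases h810 with h | h | h
  · rw [h] at hμ ⊢
    have e1 : Nat.choose 8 5 = 56 := by decide
    have e2 : Nat.choose 8 4 = 70 := by decide
    rw [e1, e2] at hμ
    nlinarith
  · rw [h] at hμ ⊢
    have e1 : Nat.choose 9 5 = 126 := by decide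
    have e2 : Nat.choose 9 4 = 126 := by decide
    rw [e1, e2] at hμ
    nlinarith
  · rw [h] at hμ ⊢
    have e1 : Nat.choose 10 5 = 252 := by decide
    have e2 : Nat.choose 10 4 = 210 := by decide
    rw [e1, e2] at hμ
    nlinarith

end S1

end PercRepro
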